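import Summits.CriticalPhenomena.SAWScalingLimit.Theorems.MassRatio.Negative.Brick
import Summits.CriticalPhenomena.SAWScalingLimit.Theorems.SAWDefectDecoherenceMassRatioRenewalDictionaryB
import Literature.Probability.RandomPlanarGeometry.HexSAWStrip

/-!
# The Duminil-Copin–Smirnov strips as honeycomb domains: simple connectivity

Helper file for the crux `NoFoldBound` (stmt-CriticalPhenomena-8296) of the route `SAWDevelopingMap`
(sub-problem `SAWScalingLimit` of `CriticalPhenomena`), programme FLAT / PEELED LP of the lead seats
c9–c10 (`FLAT-FINITE.md`, `FLAT-LEAN-DESIGN.md` on the item), brick L2(ii). The flat instance of the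
returning-loop bound is an inequality for the trapezoidal strips `S_{T,L}` of Duminil-Copin–Smirnov
(`HV.stripV T L`, `HexSAWStrip.lean`: levels `0 … 2T−1`, cut obliquely at distance `L`), uniformly in
`T, L`; every sub-domain `S_{T,L} ∖ K` of the peeled linear programme must be SIMPLY CONNECTED
(`hexDomainSimplyConnected`: the complement induces a preconnected subgraph of `ℍ`) for the winding
rigidity and the DCS identity to apply. By `Peel.hexDomainSimplyConnected_sdiff` this reduces to the
strip itself, which is the content of this file:

* `stripDom T L` — the strip as a `Finset HexVertex` (image of `HV.stripV T L` under `ofHV`),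
  `mem_stripDom_iff`, and its description in the brick coordinates `bv r p` of
  `MassRatio/Negative/Brick.lean` (`toHV_bv`, `bv_mem_stripDom_iff`: row `r = x₁`, position
  `p = 2x₀ + x₁ + b`);
* `linked_compl_stripDom` — every vertex off the strip is joined OFF the strip to the base vertex
  `bv (-1) 0` below `a` (runs along rows and descents along bands of the brick toolkit, all side
  conditions linear arithmetic);
* **`stripDom_simplyConnected`** — `hexDomainSimplyConnected (stripDom T L)` for all `T, L`.
-/

noncomputable section

open scoped Classical
open Literature.Probability.LatticeModels Literature.Probability.RandomPlanarGeometry.SAW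
open Summit.CriticalPhenomena.SAWScalingLimit.Theorems.MassRatio.Negative
open Summit.CriticalPhenomena.SAWScalingLimit.Theorems.MassRatio.Renewal.BridgeDictionary (ofHV_injective)

namespace Summit.CriticalPhenomena.SAWScalingLimit.Theorems.SAWDevelopingMapNoFoldBound.Peel

/-- **The strip `S_{T,L}` as a honeycomb domain**: the image of `HV.stripV T L` under `ofHV`. -/
def stripDom (T L : ℕ) : Finset HexVertex := (HV.stripV T L).map ⟨ofHV, ofHV_injective⟩

variable {T L : ℕ}

/-- Membership in the strip domain, through coordinates. -/
theorem mem_stripDom_iff {f : HexVertex} : f ∈ stripDom T L ↔ toHV f ∈ HV.stripV T L := by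
  unfold stripDom
  rw [Finset.mem_map]
  constructor
  · rintro ⟨w, hw, rfl⟩; simpa using hw
  · intro h; exact ⟨toHV f, h, ofHV_toHV f⟩

/-- Brick coordinates to `HV` coordinates. -/
theorem toHV_bv : ∀ r p : ℤ, toHV (Summit.CriticalPhenomena.SAWScalingLimit.Theorems.MassRatio.Negative.bv r p) = ((p - r - (p - r) % 2) / 2, r, decide ((p - r) % 2 ≠ 0)) := by
  intro r p
  unfold toHV bv
  by_cases h : (p - r) % 2 = 0
  · simp [h]
  · simp [h]

/-- **The strip in brick coordinates**: `bv r p ∈ S_{T,L}` iff `0 ≤ r`, `2r + m ≤ 2T − 1`,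
`−L − r − m ≤ x₀ ≤ L`, where `m = (p − r) mod 2` is the type bit and `x₀ = (p − r − m)/2`. -/
theorem bv_mem_stripDom_iff (r p : ℤ) :
    bv r p ∈ stripDom T L ↔ 0 ≤ r ∧ 2 * r + (p - r) % 2 ≤ 2 * (T : ℤ) - 1 ∧
      -(L : ℤ) - r - (p - r) % 2 ≤ (p - r - (p - r) % 2) / 2 ∧ (p - r - (p - r) % 2) / 2 ≤ L := by
  rw [mem_stripDom_iff, toHV_bv, HV.mem_stripV_iff]
  by_cases h : (p - r) % 2 = 0
  · simp [h, HV.bit]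
  · have h1 : (p - r) % 2 = 1 := by omega
    simp [h1, HV.bit]

/-- Off the strip, as membership in the complement set. -/
theorem bv_mem_compl (r p : ℤ)
    (h : ¬ (0 ≤ r ∧ 2 * r + (p - r) % 2 ≤ 2 * (T : ℤ) - 1 ∧
      -(L : ℤ) - r - (p - r) % 2 ≤ (p - r - (p - r) % 2) / 2 ∧ (p - r - (p - r) % 2) / 2 ≤ L)) :
    bv r p ∈ ((↑(stripDom T L) : Set HexVertex))ᶜ := by
  rw [Set.mem_compl_iff, Finset.mem_coe, bv_mem_stripDom_iff]
  exact h

/-- **Every vertex off the strip is linked, off the strip, to the base vertex `bv (-1) 0`.** -/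
theorem linked_compl_stripDom {v : HexVertex} (hv : v ∈ ((↑(stripDom T L) : Set HexVertex))ᶜ) :
    Linked ((↑(stripDom T L) : Set HexVertex))ᶜ v (bv (-1) 0) := by
  set S : Set HexVertex := ((↑(stripDom T L) : Set HexVertex))ᶜ with hS
  have nm : ∀ r p : ℤ, ¬ (0 ≤ r ∧ 2 * r + (p - r) % 2 ≤ 2 * (T : ℤ) - 1 ∧
      -(L : ℤ) - r - (p - r) % 2 ≤ (p - r - (p - r) % 2) / 2 ∧ (p - r - (p - r) % 2) / 2 ≤ L) →
      bv r p ∈ S := fun r p h => bv_mem_compl r p h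
  -- coordinates of `v`
  obtain ⟨r, p, rfl⟩ : ∃ r p : ℤ, v = bv r p := ⟨row v, pos v, (bv_row_pos v).symm⟩
  have hout : ¬ (0 ≤ r ∧ 2 * r + (p - r) % 2 ≤ 2 * (T : ℤ) - 1 ∧
      -(L : ℤ) - r - (p - r) % 2 ≤ (p - r - (p - r) % 2) / 2 ∧ (p - r - (p - r) % 2) / 2 ≤ L) := by
    rwa [hS, Set.mem_compl_iff, Finset.mem_coe, bv_mem_stripDom_iff] at hv
  -- useful runs / bands
  -- (1) along a negative row, everything is outside
  have runNeg : ∀ (r' a b : ℤ), r' < 0 → Linked S (bv r' a) (bv r' b) := by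
    intro r' a b hr'
    rcases le_total a b with hab | hab
    · exact linked_run' r' a b hab fun t _ _ => nm _ _ (by omega)
    · exact (linked_run' r' b a hab fun t _ _ => nm _ _ (by omega)).symm
  -- (2) the base column at position 0 through the negative rows
  have bandNeg : ∀ r' : ℤ, r' < 0 → Linked S (bv r' 0) (bv (-1) 0) := by
    intro r' hr'
    exact (linked_band 0 r' (-1) (by omega) fun t _ ht => ⟨nm _ _ (by omega), nm _ _ (by omega)⟩).symm
  set P : ℤ := 2 * L + 2 * T + 6 with hP
  -- (3) the far right column at position `P`, rows `-1 … r`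
  have bandR : ∀ r' : ℤ, -1 ≤ r' → Linked S (bv r' P) (bv (-1) P) := by
    intro r' hr'
    exact linked_band P (-1) r' hr' fun t _ _ => ⟨nm _ _ (by omega), nm _ _ (by omega)⟩
  -- (4) the far left column at position `-P`, rows `-1 … r`
  have bandL : ∀ r' : ℤ, -1 ≤ r' → Linked S (bv r' (-P)) (bv (-1) (-P)) := by
    intro r' hr'
    exact linked_band (-P) (-1) r' hr' fun t _ _ => ⟨nm _ _ (by omega), nm _ _ (by omega)⟩
  by_cases hr : r < 0
  · -- below the strip
    exact (runNeg r p 0 hr).trans (bandNeg r hr)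
  push Not at hr
  by_cases hright : 2 * (T : ℤ) - 1 < 2 * r + (p - r) % 2 ∨ (L : ℤ) < (p - r - (p - r) % 2) / 2
  · -- above the strip or to the right of it: run right to `P`, descend, come back along row `-1`
    have step1 : Linked S (bv r p) (bv r P) := by
      rcases le_total p P with h | h
      · exact linked_run' r p P h fun t ht _ => nm _ _ (by omega)
      · exact (linked_run' r P p h fun t ht _ => nm _ _ (by omega)).symm
    exact (step1.trans (bandR r (by omega))).trans (runNeg (-1) P 0 (by omega))
  · -- to the left of the oblique cut: run left to `-P`, descend, come back along row `-1`
    have hleft : (p - r - (p - r) % 2) / 2 < -(L : ℤ) - r - (p - r) % 2 := by omega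
    have step1 : Linked S (bv r p) (bv r (-P)) := by
      rcases le_total (-P) p with h | h
      · exact (linked_run' r (-P) p h fun t _ ht => nm _ _ (by omega)).symm
      · exact linked_run' r p (-P) h fun t _ ht => nm _ _ (by omega)
    exact (step1.trans (bandL r (by omega))).trans (runNeg (-1) (-P) 0 (by omega))

/-- **The strips `S_{T,L}` are simply connected** (their complement in `ℍ` is connected), for all
`T, L`. -/
theorem stripDom_simplyConnected (T L : ℕ) : hexDomainSimplyConnected (stripDom T L) :=
  preconnected_of_linked fun _ hu _ hv =>
    (linked_compl_stripDom hu).trans (linked_compl_stripDom hv).symm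

end Summit.CriticalPhenomena.SAWScalingLimit.Theorems.SAWDevelopingMapNoFoldBound.Peel
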